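import Mathlib
import Literature.Computability.AlgebraicComplexity.StandardFamilies
import Literature.Computability.AlgebraicComplexity.HessianAtOrigin
import Summits.ValiantsHypothesis.ValiantsHypothesis.Theorems.RefutationDegreeBeyondHessianSosPlusTwo
import Summits.ValiantsHypothesis.ValiantsHypothesis.Theorems.RefutationDegreeBeyondHessianSosStubEvenTransfer
import Summits.ValiantsHypothesis.ValiantsHypothesis.Theorems.RefutationDegreeBeyondHessianNsStubConjTransl
import Summits.ValiantsHypothesis.ValiantsHypothesis.Theorems.RefutationDegreeBeyondHessianNsStubDerivFunctional

/-!
# No big flat of the permanental hypersurface through the Mignon–Ressayre point (crux `BeyondHessianNs`)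

Helper file for crux item stmt-ValiantsHypothesis-5641 (`RefutationDegree.BeyondHessianNs`),
stub `stub_noBigFlat` (S5) of the line `Sketch`.

Let `n = p + 3 ≥ 55`, `y₀ = mrPoint ℂ p` the Mignon–Ressayre zero of `per_n`, and
`m = ⌊n²/2⌋ + 1`.  We show that there is no LINEAR subspace `V` of `n × n` matrix space with
`dim V ≥ n² - m` such that `per_n(y₀ + v) = 0` for all `v ∈ V`; the hypothesis is given in the
"evaluated jet" form `Σ_{|μ| ≤ m} coeff_μ (per_n(X + y₀)) · v^μ = 0`, which is
`eval v (per_n(X + y₀)) = per_n(v + y₀)` because `deg per_n(X + y₀) ≤ n ≤ m`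
(`totalDegree_transl_le`, `perPoly_isHomogeneous`, `MvPolynomial.eval_eq'`, `eval_transl`).

Proof.  `W := ℂ y₀ + V` is a linear space containing `y₀` on which `per_n` vanishes: for
`w = s y₀ + v`, `s ≠ 0`, homogeneity gives `per_n(s y₀ + v) = sⁿ per_n(y₀ + s⁻¹ v) = 0`
(`EvenTransfer.eval_smul_perPoly`), and the case `s = 0` follows since a polynomial vanishing on
the punctured line `{v + t y₀ : t ≠ 0}` vanishes at `v` (`EvenTransfer.eval_eq_zero_of_forall_ne_zero`).
The flat bound `9 dim W + 9 ≤ 4(n-1)² + 36(n-1)` of the sibling crux `BeyondHessianSos`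
(`RefutationDegreeBeyondHessianSos.nine_mul_finrank_flat_le`) and `dim W ≥ dim V ≥ ⌈n²/2⌉ - 1`
then give `9 n² ≤ 8(n-1)² + 72(n-1)`, i.e. `p² ≤ 50 p + 95`, false for `p ≥ 52`.
-/

noncomputable section

-- single-conjunct layout: Sub = Summit, duplicated namespace component intended
set_option linter.dupNamespace false

namespace Summit.ValiantsHypothesis.ValiantsHypothesis.Theorems.RefutationDegreeBeyondHessianNs

open MvPolynomial Module Literature.Computability.AlgebraicComplexity

/-- The finite set of exponents of degree `≤ ⌊n²/2⌋ + 1` on the `n × n` variables (local notation,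
byte-identical with the line's skeleton). -/
local notation3 (prettyPrint := false) "degLE[" n "]" =>
  ((Finset.range (n ^ 2 / 2 + 1 + 1)).biUnion
    (fun k => (Finset.univ : Finset (Fin n × Fin n)).finsuppAntidiag k))

/-- Evaluation as a sum over any finite set of exponents containing the support:
`Σ_{μ ∈ S} coeff_μ g · v^μ = g(v)` (cf. `MvPolynomial.eval_eq'`). [folklore] -/
theorem sum_coe_coeff_mul_prod_pow_eq_eval {σ : Type*} [Fintype σ] {K : Type*} [CommSemiring K]
    {S : Finset (σ →₀ ℕ)} {g : MvPolynomial σ K} (hS : g.support ⊆ S) (v : σ → K) :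
    ∑ μ : ↥S, coeff μ.1 g * ∏ i, v i ^ (μ.1 i) = eval v g := by
  rw [Finset.sum_coe_sort S (fun μ => coeff μ g * ∏ i, v i ^ (μ i)), eval_eq']
  exact (Finset.sum_subset hS fun μ _ hμ => by rw [notMem_support_iff.mp hμ, zero_mul]).symm

/-- The translate `per_{p+3}(X + y)` has total degree `≤ p + 3 ≤ ⌊(p+3)²/2⌋ + 1`. [folklore] -/
theorem totalDegree_transl_perPoly_le_sq_div_two {p : ℕ} (y : Fin (p + 3) × Fin (p + 3) → ℂ) :
    (transl y (perPoly (Fin (p + 3)) ℂ)).totalDegree ≤ (p + 3) ^ 2 / 2 + 1 := by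
  refine (totalDegree_transl_le _ _).trans ?_
  refine (perPoly_isHomogeneous (n := Fin (p + 3)) (k := ℂ)).totalDegree_le.trans ?_
  rw [Fintype.card_fin]
  have h2 : 2 * (p + 3) ≤ (p + 3) ^ 2 := by
    rw [sq]; exact Nat.mul_le_mul_right _ (by omega)
  omega

/-- The evaluated jet of `per_{p+3}(X + y₀)` on the exponents of degree `≤ ⌊(p+3)²/2⌋ + 1` is the
value `per_{p+3}(v + y₀)`. [folklore] -/
theorem sum_degLE_coeff_transl_perPoly_eq_eval (p : ℕ) (v : Fin (p + 3) × Fin (p + 3) → ℂ) :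
    ∑ μ : ↥(degLE[p + 3]), coeff μ.1 (transl (mrPoint ℂ p) (perPoly (Fin (p + 3)) ℂ)) *
        ∏ i, v i ^ (μ.1 i) = eval (v + mrPoint ℂ p) (perPoly (Fin (p + 3)) ℂ) := by
  rw [sum_coe_coeff_mul_prod_pow_eq_eval (support_subset_biUnion_finsuppAntidiag
    (totalDegree_transl_perPoly_le_sq_div_two (mrPoint ℂ p))) v, eval_transl]

/-- If `per_{p+3}(v + y₀) = 0` for all `v` in a linear subspace `V`, then `per_{p+3}` vanishes on
the linear span `W = ℂ y₀ + V` (homogeneity for `s y₀ + v`, `s ≠ 0`; the punctured-line lemma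
for `s = 0`). [folklore] -/
theorem eval_perPoly_eq_zero_of_mem_span_sup {p : ℕ}
    (V : Submodule ℂ (Fin (p + 3) × Fin (p + 3) → ℂ))
    (hV : ∀ v ∈ V, eval (v + mrPoint ℂ p) (perPoly (Fin (p + 3)) ℂ) = 0)
    (w : Fin (p + 3) × Fin (p + 3) → ℂ) (hw : w ∈ Submodule.span ℂ {mrPoint ℂ p} ⊔ V) :
    eval w (perPoly (Fin (p + 3)) ℂ) = 0 := by
  obtain ⟨y, hy, v, hv, rfl⟩ := Submodule.mem_sup.mp hw
  obtain ⟨s, rfl⟩ := Submodule.mem_span_singleton.mp hy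
  -- the punctured line `v + t y₀`, `t ≠ 0`, lies in the zero set by homogeneity
  have key : ∀ t : ℂ, t ≠ 0 → eval (v + t • mrPoint ℂ p) (perPoly (Fin (p + 3)) ℂ) = 0 := by
    intro t ht
    have h1 : v + t • mrPoint ℂ p = t • (t⁻¹ • v + mrPoint ℂ p) := by
      rw [smul_add, smul_smul, mul_inv_cancel₀ ht, one_smul]
    rw [h1, RefutationDegreeBeyondHessianSos.EvenTransfer.eval_smul_perPoly,
      hV _ (V.smul_mem _ hv), mul_zero]
  by_cases hs : s = 0
  · rw [hs, zero_smul, zero_add]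
    exact RefutationDegreeBeyondHessianSos.EvenTransfer.eval_eq_zero_of_forall_ne_zero _ v
      (mrPoint ℂ p) key
  · rw [add_comm (s • mrPoint ℂ p) v]
    exact key s hs

/-- **S5 — no big flat of the permanental hypersurface through the Mignon–Ressayre point**
(registered stub `stub_noBigFlat` of the line `Sketch`, crux `BeyondHessianNs`; `n = p + 3 ≥ 55`):
there is no linear `V` with `dim V ≥ n² - (⌊n²/2⌋ + 1)` such that `per_n(y₀ + v) = 0` for all
`v ∈ V`, the latter written as `Σ_{|μ| ≤ ⌊n²/2⌋+1} coeff_μ (per_n(X + y₀)) v^μ = 0`.  (`W = ℂ y₀ + V`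
contradicts `RefutationDegreeBeyondHessianSos.nine_mul_finrank_flat_le`; module docstring.) [folklore] -/
theorem stub_noBigFlat : ∀ (p : ℕ), 52 ≤ p → ∀ V : Submodule ℂ (Fin (p + 3) × Fin (p + 3) → ℂ), (p + 3) ^ 2 ≤ Module.finrank ℂ V + ((p + 3) ^ 2 / 2 + 1) → (∀ v ∈ V, ∑ μ : ↥(degLE[p + 3]), MvPolynomial.coeff μ.1 (Literature.Computability.AlgebraicComplexity.transl (Literature.Computability.AlgebraicComplexity.mrPoint ℂ p) (Literature.Computability.AlgebraicComplexity.perPoly (Fin (p + 3)) ℂ)) * ∏ i, v i ^ (μ.1 i) = 0) → False := by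
  intro p hp V hdim hV
  -- the hypothesis says `per(v + y₀) = 0` on `V`
  have hV' : ∀ v ∈ V, eval (v + mrPoint ℂ p) (perPoly (Fin (p + 3)) ℂ) = 0 := fun v hv => by
    rw [← sum_degLE_coeff_transl_perPoly_eq_eval p v]
    exact hV v hv
  -- the linear space `W = ℂ y₀ + V ∋ y₀` lies in the zero set of `per`
  set W : Submodule ℂ (Fin (p + 3) × Fin (p + 3) → ℂ) := Submodule.span ℂ {mrPoint ℂ p} ⊔ V
    with hW
  have hy : mrPoint ℂ p ∈ W := Submodule.mem_sup_left (Submodule.mem_span_singleton_self _)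
  have hZ : ∀ w ∈ W, eval w (perPoly (Fin (p + 3)) ℂ) = 0 :=
    fun w hw => eval_perPoly_eq_zero_of_mem_span_sup V hV' w hw
  -- the flat bound of the sibling crux, and the dimension count
  have hflat := RefutationDegreeBeyondHessianSos.nine_mul_finrank_flat_le p (by omega) W hy hZ
  have hmono : finrank ℂ V ≤ finrank ℂ W := Submodule.finrank_mono le_sup_right
  have h1 : 9 * (p + 3) ^ 2 ≤ 8 * (p + 2) ^ 2 + 72 * (p + 2) := by omega
  obtain ⟨q, rfl⟩ : ∃ q, p = q + 52 := ⟨p - 52, by omega⟩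
  nlinarith [h1]

end Summit.ValiantsHypothesis.ValiantsHypothesis.Theorems.RefutationDegreeBeyondHessianNs

end
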